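import Summits.AtomisticToContinuum.Crystallization.Theorems.FrustratedLawDichotomyCellTEQ15Data

/-!
# FrustratedLawDichotomy · crux `AperiodicFrustratedLawGap` (stmt-AtomisticToContinuum-27623) — TEQ15 witness cell: class 0 sums B
# (decomp-a2c, prover hand 2, generation 17; each theorem ONE `decide +kernel`, split for the farm's per-declaration budget). [folklore]
-/

namespace Summit.AtomisticToContinuum.Crystallization.Theorems.FrustratedLawDichotomyCellTEQ15

open scoped BigOperators
open Summit.AtomisticToContinuum.Crystallization.Theorems.FrustratedLawDichotomyCellChecker
open Summit.AtomisticToContinuum.Crystallization.Theorems.FrustratedLawDichotomyCellKitX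

set_option maxHeartbeats 0 in
/-- Kernel value of the `C00` sum of class `0`. [folklore] -/
theorem teq15_sum0_C00 : sumX cellTEQ15 (termC cellTEQ15 cellTEQ15P cellTEQ15X0.bins 0 0 ⟨0, by decide⟩) = ((3218331196490815159 : ℚ) / 262144000000000000) := by decide +kernel

set_option maxHeartbeats 0 in
/-- Kernel value of the `C01` sum of class `0`. [folklore] -/
theorem teq15_sum0_C01 : sumX cellTEQ15 (termC cellTEQ15 cellTEQ15P cellTEQ15X0.bins 0 1 ⟨0, by decide⟩) = ((-38459970870256773 : ℚ) / 131072000000000000) := by decide +kernel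

set_option maxHeartbeats 0 in
/-- Kernel value of the `C02` sum of class `0`. [folklore] -/
theorem teq15_sum0_C02 : sumX cellTEQ15 (termC cellTEQ15 cellTEQ15P cellTEQ15X0.bins 0 2 ⟨0, by decide⟩) = ((-84489285366738769 : ℚ) / 52428800000000000) := by decide +kernel

set_option maxHeartbeats 0 in
/-- Kernel value of the `C11` sum of class `0`. [folklore] -/
theorem teq15_sum0_C11 : sumX cellTEQ15 (termC cellTEQ15 cellTEQ15P cellTEQ15X0.bins 1 1 ⟨0, by decide⟩) = ((3060231316464592961 : ℚ) / 262144000000000000) := by decide +kernel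

end Summit.AtomisticToContinuum.Crystallization.Theorems.FrustratedLawDichotomyCellTEQ15
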